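import Mathlib
import Summits.MatrixMultiplication.MatrixMultiplication.Theorems.SubgroupIdentityDesigns.Negative.FibreGhost

/-!
# Orbit-counting certificates: the three-member exclusion engine for level-one identity designs (all `p`)

Route `LevelGradedCohnUmans`, crux `SubgroupIdentityDesigns` (stmt-MatrixMultiplication-14079), the
`(m,k) = (2,1)` cell.  VALUE = THEOREM (an all-`p` engine), NOT summit progress; the crux item is
untouched and remains open.

A level-`1` function `F(g) = Σ_{rk M ≤ 1} c_M ψ(tr(M g))` on `GL₂(𝔽_p)` is a constant plus a sum of
functions of ONE VECTOR `g ↦ φ(g u)` (`exists_vecMulVec_of_rank_le_one`, `trace_vecMulVec_mul`).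
Hence for three subgroups `H₁, H₂, H₃` and ANY weight `a(h₁, k, h₃)` on `H₁ × H₂ × H₃` whose
push-forward incidence counts vanish,

  `Σ_{h₁ ∈ H₁, k ∈ H₂, h₃ ∈ H₃, h₁ k h₃ u = w} a(h₁, k, h₃) = 0`  for all vectors `u, w ∈ 𝔽_p²`
  (`u = w = 0` included: it says `Σ a = 0`),

the weighted sum `Σ a(h₁,k,h₃) F(h₁ k h₃)` vanishes for every level-`1` function `F`
(`sum_triple_weight_fourier_eq_zero`).  If the triple is subgroup-TPP and `a(1,1,1) ≠ 0`, a level-`1`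
identity design (`F(1) = 1`, `F = 0` on `H₁H₂H₃ ∖ 1`) would give `Σ a F = a(1,1,1) F(1) ≠ 0`:
contradiction (`no_levelOne_design_of_triple_certificate`).  This is the THREE-MEMBER form of the
single-member coset certificate (`CosetCertificate.lean`) and of the orbit pairs (`OrbitPair.lean`);
by linear duality it is COMPLETE for the trivial isotypic block of the design problem.  Two usable
specialisations: the weight lives on the middle member and the condition is an ORBIT COUNT over
`H₁ × H₃` (`no_levelOne_design_of_orbit_certificate`: `Σ_k a(k) · #{(h₁,h₃) : h₁ k h₃ u = w} = 0`),
and its two-term case `a = δ_1 − δ_b` (`no_levelOne_design_of_balanced_element`: some `b ∈ H₂ ∖ 1`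
has the same `(H₁,H₃)`-incidence counts `#{(h₁,h₃) : h₁ b h₃ u = w}` as `b = 1`, for all `u, w`).
Census use (route folder `ORACLE-g16.md` §G16-4, kit job j126482): at `p = 31` every subgroup-TPP
triple of the only order profile surviving the sieve, `(90, 120 = SL(2,5), 150)`, carries such a
certificate for all three choices of the middle member.  All `p`; no volume hypothesis.
-/

set_option linter.dupNamespace false

noncomputable section

open scoped BigOperators Classical

open Summit.MatrixMultiplication.MatrixMultiplication.Theorems.LieRankDesigns.Negative (GLm Mat)

namespace Summit.MatrixMultiplication.MatrixMultiplication.Theorems.SubgroupIdentityDesigns.Negative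

section OrbitCertificate

open Literature.Barriers.MatrixMultiplication (SubgroupTPP)

variable {p : ℕ} [hp : Fact p.Prime]

/-- **Vanishing incidence counts kill functions of one vector (three members).**  If for a fixed
vector `u` the `a`-weighted number of triples `(h₁, k, h₃) ∈ H₁ × H₂ × H₃` with `h₁ k h₃ u = w`
vanishes for every `w`, then `Σ a(h₁,k,h₃) g(h₁ k h₃ u) = 0` for every function `g` of one vector. -/
theorem sum_triple_weight_mulVec_eq_zero (H₁ H₂ H₃ : Subgroup (GLm p 2))
    (a : GLm p 2 → GLm p 2 → GLm p 2 → ℂ) (u : Fin 2 → ZMod p)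
    (horb : ∀ w : Fin 2 → ZMod p, (∑ h₁ : H₁, ∑ k : H₂, ∑ h₃ : H₃,
      if (((h₁ : GLm p 2) * k * h₃ : GLm p 2) : Mat p 2).mulVec u = w
        then a h₁ k h₃ else 0) = 0)
    (g : (Fin 2 → ZMod p) → ℂ) :
    ∑ h₁ : H₁, ∑ k : H₂, ∑ h₃ : H₃,
      a h₁ k h₃ * g ((((h₁ : GLm p 2) * k * h₃ : GLm p 2) : Mat p 2).mulVec u) = 0 := by
  have H : ∑ w : Fin 2 → ZMod p, g w * (∑ h₁ : H₁, ∑ k : H₂, ∑ h₃ : H₃,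
      if (((h₁ : GLm p 2) * k * h₃ : GLm p 2) : Mat p 2).mulVec u = w
        then a h₁ k h₃ else 0) =
      ∑ h₁ : H₁, ∑ k : H₂, ∑ h₃ : H₃,
        a h₁ k h₃ * g ((((h₁ : GLm p 2) * k * h₃ : GLm p 2) : Mat p 2).mulVec u) := by
    simp_rw [Finset.mul_sum]
    rw [Finset.sum_comm]
    refine Finset.sum_congr rfl fun h₁ _ => ?_
    rw [Finset.sum_comm]
    refine Finset.sum_congr rfl fun k _ => ?_
    rw [Finset.sum_comm]
    refine Finset.sum_congr rfl fun h₃ _ => ?_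
    rw [Finset.sum_eq_single ((((h₁ : GLm p 2) * k * h₃ : GLm p 2) : Mat p 2).mulVec u)]
    · rw [if_pos rfl, mul_comm]
    · intro w _ hw
      rw [if_neg (Ne.symm hw), mul_zero]
    · intro h
      exact absurd (Finset.mem_univ _) h
  rw [← H]
  simp only [horb, mul_zero, Finset.sum_const_zero]

/-- **Vanishing incidence counts kill level-one functions (three members).**  If the `a`-weighted
incidence counts `Σ_{h₁ k h₃ u = w} a(h₁,k,h₃)` vanish for ALL `u, w` (the case `u = w = 0` says
`Σ a = 0`), then `Σ a(h₁,k,h₃) F(h₁ k h₃) = 0` for every level-`1` function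
`F = Σ_{rk M ≤ 1} c_M ψ(tr(M ·))`. -/
theorem sum_triple_weight_fourier_eq_zero (H₁ H₂ H₃ : Subgroup (GLm p 2))
    (a : GLm p 2 → GLm p 2 → GLm p 2 → ℂ)
    (horb : ∀ u w : Fin 2 → ZMod p, (∑ h₁ : H₁, ∑ k : H₂, ∑ h₃ : H₃,
      if (((h₁ : GLm p 2) * k * h₃ : GLm p 2) : Mat p 2).mulVec u = w
        then a h₁ k h₃ else 0) = 0)
    (c : Mat p 2 → ℂ) (hc : ∀ M : Mat p 2, 1 < M.rank → c M = 0) :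
    ∑ h₁ : H₁, ∑ k : H₂, ∑ h₃ : H₃, a h₁ k h₃ * ∑ M : Mat p 2,
      c M * ZMod.stdAddChar
        (Matrix.trace (M * (((h₁ : GLm p 2) * k * h₃ : GLm p 2) : Mat p 2))) = 0 := by
  have hswap : ∑ M : Mat p 2, c M * ∑ h₁ : H₁, ∑ k : H₂, ∑ h₃ : H₃, a h₁ k h₃ *
      ZMod.stdAddChar (Matrix.trace (M * (((h₁ : GLm p 2) * k * h₃ : GLm p 2) : Mat p 2))) =
      ∑ h₁ : H₁, ∑ k : H₂, ∑ h₃ : H₃, a h₁ k h₃ * ∑ M : Mat p 2,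
        c M * ZMod.stdAddChar
          (Matrix.trace (M * (((h₁ : GLm p 2) * k * h₃ : GLm p 2) : Mat p 2))) := by
    simp_rw [Finset.mul_sum]
    rw [Finset.sum_comm]
    refine Finset.sum_congr rfl fun h₁ _ => ?_
    rw [Finset.sum_comm]
    refine Finset.sum_congr rfl fun k _ => ?_
    rw [Finset.sum_comm]
    refine Finset.sum_congr rfl fun h₃ _ => Finset.sum_congr rfl fun M _ => by ring
  rw [← hswap]
  refine Finset.sum_eq_zero fun M _ => ?_
  by_cases hcM : c M = 0
  · rw [hcM, zero_mul]
  have hM : M.rank ≤ 1 := by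
    by_contra h
    exact hcM (hc M (by omega))
  by_cases hM0 : M = 0
  · subst hM0
    have h := sum_triple_weight_mulVec_eq_zero H₁ H₂ H₃ a 0 (horb 0) (fun _ => 1)
    simp only [mul_one] at h
    simp [h]
  obtain ⟨u, b, _, rfl⟩ := exists_vecMulVec_of_rank_le_one M hM hM0
  simp_rw [trace_vecMulVec_mul]
  rw [sum_triple_weight_mulVec_eq_zero H₁ H₂ H₃ a u (horb u)
    (fun w => ZMod.stdAddChar (b ⬝ᵥ w)), mul_zero]

/-- **TRIPLE CERTIFICATE ⇒ NO LEVEL-ONE IDENTITY DESIGN.**  `(H₁, H₂, H₃)` subgroup-TPP, a weight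
`a` on `H₁ × H₂ × H₃` with `a(1,1,1) ≠ 0` whose incidence counts `Σ_{h₁ k h₃ u = w} a(h₁,k,h₃)` vanish
for all vectors `u, w`: then the level-`1` identity design of the crux (a rank-`≤ 1`-supported `c`
with `F_c(1) = 1` and `F_c = 0` on `H₁H₂H₃ ∖ 1`) does not exist.  All `p`, no volume hypothesis;
TPP is used only to read off `Σ a F = a(1,1,1)·F(1)`. -/
theorem no_levelOne_design_of_triple_certificate {H₁ H₂ H₃ : Subgroup (GLm p 2)}
    (htpp : SubgroupTPP H₁ H₂ H₃) (a : GLm p 2 → GLm p 2 → GLm p 2 → ℂ) (ha1 : a 1 1 1 ≠ 0)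
    (horb : ∀ u w : Fin 2 → ZMod p, (∑ h₁ : H₁, ∑ k : H₂, ∑ h₃ : H₃,
      if (((h₁ : GLm p 2) * k * h₃ : GLm p 2) : Mat p 2).mulVec u = w
        then a h₁ k h₃ else 0) = 0) :
    ¬ ∃ c : Mat p 2 → ℂ, (∀ M, 1 < M.rank → c M = 0) ∧
      (∑ M, c M * ZMod.stdAddChar (Matrix.trace (M * ((1 : GLm p 2) : Mat p 2)))) = 1 ∧
      ∀ a ∈ H₁, ∀ b ∈ H₂, ∀ g ∈ H₃, a * b * g ≠ 1 →
        (∑ M, c M *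
          ZMod.stdAddChar (Matrix.trace (M * ((a * b * g : GLm p 2) : Mat p 2)))) = 0 := by
  rintro ⟨c, hc, hc1, hc0⟩
  have h0 := sum_triple_weight_fourier_eq_zero H₁ H₂ H₃ a horb c hc
  rw [Fintype.sum_eq_single (1 : H₁)] at h0
  · rw [Fintype.sum_eq_single (1 : H₂)] at h0
    · rw [Fintype.sum_eq_single (1 : H₃)] at h0
      · simp only [Subgroup.coe_one, mul_one] at h0
        rw [hc1, mul_one] at h0
        exact ha1 h0
      · intro h₃ hh₃
        have hne : ((1 : H₁) : GLm p 2) * ((1 : H₂) : GLm p 2) * (h₃ : GLm p 2) ≠ 1 := by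
          rw [Subgroup.coe_one, Subgroup.coe_one, one_mul, one_mul]
          exact fun h => hh₃ (Subtype.ext h)
        rw [hc0 _ (1 : H₁).2 _ (1 : H₂).2 _ h₃.2 hne, mul_zero]
    · intro k hk
      refine Finset.sum_eq_zero fun h₃ _ => ?_
      have hne : ((1 : H₁) : GLm p 2) * (k : GLm p 2) * (h₃ : GLm p 2) ≠ 1 := fun h =>
        hk (Subtype.ext (htpp _ (1 : H₁).2 _ k.2 _ h₃.2 h).2.1)
      rw [hc0 _ (1 : H₁).2 _ k.2 _ h₃.2 hne, mul_zero]
  · intro h₁ hh₁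
    refine Finset.sum_eq_zero fun k _ => Finset.sum_eq_zero fun h₃ _ => ?_
    have hne : (h₁ : GLm p 2) * (k : GLm p 2) * (h₃ : GLm p 2) ≠ 1 := fun h =>
      hh₁ (Subtype.ext (htpp _ h₁.2 _ k.2 _ h₃.2 h).1)
    rw [hc0 _ h₁.2 _ k.2 _ h₃.2 hne, mul_zero]

/-- **ORBIT-COUNTING CERTIFICATE** (weight on the middle member).  If `a : H₂ → ℂ` has `a(1) ≠ 0`
and `Σ_{k ∈ H₂} a(k) · #{(h₁, h₃) ∈ H₁ × H₃ : h₁ k h₃ u = w} = 0` for all vectors `u, w` — a finite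
linear system indexed by the pairs (`H₃`-orbit of `u`, `H₁`-orbit of `w`) — then the subgroup-TPP
triple `(H₁, H₂, H₃)` has no level-`1` identity design.  All `p`. -/
theorem no_levelOne_design_of_orbit_certificate {H₁ H₂ H₃ : Subgroup (GLm p 2)}
    (htpp : SubgroupTPP H₁ H₂ H₃) (a : GLm p 2 → ℂ) (ha1 : a 1 ≠ 0)
    (horb : ∀ u w : Fin 2 → ZMod p, (∑ h₁ : H₁, ∑ k : H₂, ∑ h₃ : H₃,
      if (((h₁ : GLm p 2) * k * h₃ : GLm p 2) : Mat p 2).mulVec u = w then a k else 0) = 0) :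
    ¬ ∃ c : Mat p 2 → ℂ, (∀ M, 1 < M.rank → c M = 0) ∧
      (∑ M, c M * ZMod.stdAddChar (Matrix.trace (M * ((1 : GLm p 2) : Mat p 2)))) = 1 ∧
      ∀ a ∈ H₁, ∀ b ∈ H₂, ∀ g ∈ H₃, a * b * g ≠ 1 →
        (∑ M, c M *
          ZMod.stdAddChar (Matrix.trace (M * ((a * b * g : GLm p 2) : Mat p 2)))) = 0 :=
  no_levelOne_design_of_triple_certificate htpp (fun _ k _ => a k) ha1 horb

/-- **BALANCED ELEMENT** (the two-term certificate `a = δ_1 − δ_b`).  If some `b ∈ H₂ ∖ 1` has the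
same `(H₁, H₃)`-incidence counts as the identity, `#{(h₁,h₃) : h₁ b h₃ u = w} = #{(h₁,h₃) : h₁ h₃ u = w}`
for all vectors `u, w`, then the subgroup-TPP triple `(H₁, H₂, H₃)` has no level-`1` identity design.
All `p`. -/
theorem no_levelOne_design_of_balanced_element {H₁ H₂ H₃ : Subgroup (GLm p 2)}
    (htpp : SubgroupTPP H₁ H₂ H₃) {b : GLm p 2} (hb : b ∈ H₂) (hb1 : b ≠ 1)
    (hbal : ∀ u w : Fin 2 → ZMod p,
      (∑ h₁ : H₁, ∑ h₃ : H₃,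
        if (((h₁ : GLm p 2) * b * h₃ : GLm p 2) : Mat p 2).mulVec u = w then (1 : ℂ) else 0) =
      ∑ h₁ : H₁, ∑ h₃ : H₃,
        if (((h₁ : GLm p 2) * h₃ : GLm p 2) : Mat p 2).mulVec u = w then (1 : ℂ) else 0) :
    ¬ ∃ c : Mat p 2 → ℂ, (∀ M, 1 < M.rank → c M = 0) ∧
      (∑ M, c M * ZMod.stdAddChar (Matrix.trace (M * ((1 : GLm p 2) : Mat p 2)))) = 1 ∧
      ∀ a ∈ H₁, ∀ b ∈ H₂, ∀ g ∈ H₃, a * b * g ≠ 1 →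
        (∑ M, c M *
          ZMod.stdAddChar (Matrix.trace (M * ((a * b * g : GLm p 2) : Mat p 2)))) = 0 := by
  refine no_levelOne_design_of_orbit_certificate htpp
    (fun k => if k = 1 then 1 else if k = b then -1 else 0) (by simp) fun u w => ?_
  rw [Finset.sum_comm]
  rw [Fintype.sum_eq_add (1 : H₂) ⟨b, hb⟩ (fun h => hb1 (congrArg Subtype.val h).symm)]
  · simp only [Subgroup.coe_one, mul_one, if_true]
    have hb1' : ¬ (b = 1) := hb1
    simp only [hb1', if_false]
    have hneg : ∀ (x : H₁) (y : H₃),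
        (if (((x : GLm p 2) * b * y : GLm p 2) : Mat p 2).mulVec u = w then (-1 : ℂ) else 0) =
        -(if (((x : GLm p 2) * b * y : GLm p 2) : Mat p 2).mulVec u = w then (1 : ℂ) else 0) :=
      fun x y => by split_ifs <;> simp
    simp_rw [hneg, Finset.sum_neg_distrib, hbal u w, add_neg_cancel]
  · rintro k ⟨hk1, hkb⟩
    have hk1' : (k : GLm p 2) ≠ 1 := fun h => hk1 (Subtype.ext h)
    have hkb' : (k : GLm p 2) ≠ b := fun h => hkb (Subtype.ext h)
    refine Finset.sum_eq_zero fun h₁ _ => Finset.sum_eq_zero fun h₃ _ => ?_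
    simp [hk1', hkb']

end OrbitCertificate

end Summit.MatrixMultiplication.MatrixMultiplication.Theorems.SubgroupIdentityDesigns.Negative

end
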